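import Summits.QuantumFields.YangMills.Theorems.BalabanUVNodesN07TildeTowerLettersBoxDatum
import Summits.QuantumFields.YangMills.Theorems.BalabanUVNodesN07DatumGauge152Guarded
import HarnessLib

/-!
# DAG node N07 [B11] — THE □̃-TOWER LETTERS AT THE TOKEN's BINDERS: the widened-□̃ fine-regularity clause `h52`, its `α₀`-ranges, strict non-wrapping, and the radial shear
# gauge `uL` with its □̃-tower ∕ canonical-box `v`-rows, INSTANTIATED at `s : SeqOfRecord F ν M g K k`, `suppDomOfRecord`, the V20-G guard `c ≤ ν.M₁ ∧ k + c₀ ≤ F.m + K`,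
# the BOX-FORM meet and the token's ranges — FILE 2 of 2 (FILE 1 `…N07TildeTowerLettersBoxDatum` is the generic-datum layer)

Cell `pub-ymgap` (HUMAN RULINGS D-0062 ∕ D-0088 ∕ D-0149), width seat `pub-ymgap-dag-n07-w6` (second wave), harness re-seat g3, 2026-08-28; CLAIM-1 ∕ INTENT-1 (cell bus I.40165).
`--kind proof --supports stmt-QuantumFields-27364 --as helper` (K1⁹ per dag-lead KEY MAP v2; count-neutral).  THEOREMS ONLY.

THE POINT.  The S6 head's knit of record (dag-n07-w4 g4 FILE 7 `…N07SplitClauseHeadKnitRanged`, p642949 :102–:155) owes `HCHART` at CLEAN datums `(K − n, idx)` of the token,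
read with the box-form meeting antecedent `∃ x ∈ box L (cornerP Mc ρ idx) (sideP Mc ρ) (K−n), ∃ y, π y ∈ Ω_{K−n} ∧ Within 3 x y` (dag-n07-e's located binder of record); its
data-lane rows `hv` (:147–:149) read `dist1 (M^{j'}((U₁)^{uL}) c) ≤ v ε δ (K−n) j'` on p627154's canonical boxes.  dag-n07-w8 g6's (r2) door (FILE 18 `…N07ShearLetterOfFine`,
p642925) displays, at a generic datum, the data-lane binders `h52`, the `α₀` ranges, the radial tower `hax` of `(U^{u})^{uL}` and its top row on `□̃^{(k)}`.  THIS FILE supplies all of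
them at the token's binders VERBATIM (the shape of dag-n07-w3 g7's `…N07DatumGauge152GuardedBox` :120, which the head consumes at FILE 7 :182): `s : SeqOfRecord F ν M g K k`,
`Sect2.SeqSeparated ν.M₁ s`, the guard, `ε` with `∀ m ≤ k, 0 < ε m ∧ ε m ≤ a₀` (and `ε m ≤ 2ε(m+1)` for the corollary), the (17) clause `h17` on
`Sect2.omegaPlaqsTop s.Ω (suppDomOfRecord F ν K s.Ω)`, the datum `1 ≤ j ≤ k`, `idx`, the BOX-FORM meet, the four canonical-box equations — with three displayed side letters on the
head's ∃-chosen constants `c c₀ a₀` (all monotone): the floor `F.L·(Mc + 44 + 4ρ + 2(F.L + (8F.L + 2))) + 3 ≤ c` (exceeds the head's `(47 + 4ρ + Mc)·F.L ≤ c`), the STRICT period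
letter `Mc + 44 + 6ρ + 1 ≤ 2F.L^{c₀}` (the head's `≤` is `=` in the corner case `ρ ∣ Mc + 44`), and two `a₀`-smallness letters `143·16²·(F.L²a₀) ≤ ⅓`, `2F.L²a₀ ≤ 2δ_N∕(8F.L)²`.

WHAT THIS FILE DOES (by-name composition + `sitesPerDir` ∕ real arithmetic; NOTHING of [B11]∕[6]∕[B7]∕[III] analysis asserted).
* ★★ `plaqSmallOn_tildeTowerWide_at_token`: `h52` VERBATIM at `(a, M, k) := (cornerP Mc ρ idx, sideP Mc ρ, j)`, `α₀ := L²·ε(j−1)`, from `h17` at level `j − 1` (FILE 1 §1 +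
  p642198 `mul_eta_pred_sq`; `suppDomOfRecord = hullD … ν.M₁ 1 (Ω 1)` is `rfl`).
* ★ `alpha_ranges_of_le` (the ranges at `L²ε′` from `ε′ ≤ a₀`), ★ `sideP_add_lt_sitesPerDir_of_levelGuard` (strict non-wrapping from the level guard, dag-n07-w3 §1 BY NAME),
  `ladder_mono` (the explicit ladder is monotone in `α₀`).
* ★★★ `exists_shearGauge_radialRep_rows_at_token`: for ANY `u`, `∃ uL` with (i) the radial tower of `(U^{u})^{uL}` below `j` (dag-n07-w8's `hax`), (ii) the □̃-tower rows ∀ `j' ≤ j`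
  (⊇ `htop` at `j' = j`), (iii) `HCHART`'s `hv` rows on the canonical boxes — bound = FILE 1's explicit ladder at `α₀ := L²·ε(j−1)`; ★★ `…_at_token_of_comp`: the same with the
  bound at `2L²·ε_j` (token comparability `ε(j−1) ≤ 2ε_j`) — the letter function `v ε δ j j'` the head's `HLETTERS` can range at level `j` alone.

HONEST FRAMING (binding).  Count-neutral helper; by-name composition of LANDED theorems (FILE 1; this base p642198; dag-n07-w3 p631846 §1; node00 `suppDomOfRecord` (rfl),
`TorusCoverCubeMemberPrint.sideP_le ∕ le_sideP`); the token's (17) clause, separation, the guard, the ranges, the box meet and the three side letters are HYPOTHESES ∕ the consumer's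
∃-choices; joint satisfiability with the head's `HLETTERS`∕`HBUDGET` NOT claimed; the `av`-rows (Landau copy) are NOT here; nothing of [B11]∕[6]∕[B7]∕[III] analysis asserted;
`HCHART` NOT discharged; `stub_prop8StepCoPG13` ∕ K0⁷ ∕ K1⁹ NOT closed; N07 NOT discharged; the chair's tally of record is the only count; **no summit statement is proved by this
seat** — one finite `T⁴` programme at fixed `ε`, Bałaban AS PRINTED; the route closes the conditional finite-𝕋⁴ rung `BalabanLadder.UV` only; NOT continuum ∕ ℝ⁴ ∕ OS ∕ mass gap
∕ Clay.  No `sorry`, no `def`, no `instance`, no `notation`.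

RELATED IN THE TREE, NOT DUPLICATED: FILE 1 (CONSUMED), p642198 (grid-cube meet, generic `Seq`), dag-n07-w8 g6 `…N07ShearLetterOfFine` ∕ `…N07ShearLetterAtDatum` (CONSUMERS),
dag-n07-w3 g7 `…N07DatumGauge152Guarded(Box)` (the S3 door at the same binders; §1 there CONSUMED).

References: [B11] = [Balaban1985Variational] (17) p. 279, (144) p. 300, (145)–(147), (151) p. 301; [6] = [Balaban1985RegularSpaces] (1.3)–(1.7) p. 77, (1.15) p. 78, Lemma 1 (1.25)
p. 79, p. 98; [B7] = [Balaban1985Averaging] Prop. 2 (52)–(53) p. 26; [III] = [Balaban1988Convergent] p. 255, (2.13) p. 256; [Balaban1987RG1] (0.1) p. 251.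
-/

noncomputable section

namespace Summit.QuantumFields.YangMills.BalabanUVNodes.N07TildeTowerLettersAtToken

open scoped Matrix.Norms.L2Operator BigOperators
open Literature.MathematicalPhysics.QuantumFieldTheory.Balaban1983to89
open Literature.MathematicalPhysics.QuantumFieldTheory.Balaban1983to89.Node00
open T4Continuum
open T4AxialGaugeSmallField (castSite castSite_apply axialGauge boxPlaqs)
open B15Eq177GaugeInvariance (blockLift)
open B15Eq112TorusCover (cover)
open B14DomainGeom (Pt Within)
open GaugeField (gaugeAct)
open ExpMeanLog (deltaSU deltaSU_pos)
open B8Eq131Cubes (gs sqLo sqHi tLo tHi box)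
open B8Ineq130 (tlo thi)
open Summit.QuantumFields.Balaban3D.Carriers (radialContourData)
open Summit.QuantumFields.YangMills.BalabanUVNodes.N07TildeTowerLettersAtDatum (mul_eta_pred_sq plaqSmallOn_gaugeAct_iff)
open Summit.QuantumFields.YangMills.BalabanUVNodes.N07TildeTowerLettersBoxDatum (mem_omegaPlaqsTop_pred_of_mem_box_of_mem_tildeTowerWide_zero exists_shearGauge_radialRep_rows_of_fine)
open Summit.QuantumFields.YangMills.BalabanUVNodes.N07DatumGauge152Guarded (two_mul_pow_le_sitesPerDir_of_levelGuard)

/-! ## §1  Placement, ranges and non-wrapping at the token -/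

section Token

variable {F : T4Continuum.T4Family} {N : ℕ} [NeZero N]

/-- ★★ **THE WIDENED-□̃ FINE-REGULARITY CLAUSE AT A CLEAN ANCHORED DATUM OF THE TOKEN** (dag-n07-w8 FILE 18's ∕ p640582's `h52` binder VERBATIM at `(a, M, k) := (cornerP Mc ρ idx,
sideP Mc ρ, j)` and `α₀ := L²·ε(j−1)`): from the token's (17) clause `h17` at level `j − 1` on `Sect2.omegaPlaqsTop s.Ω (suppDomOfRecord F ν K s.Ω) (j−1)` (`= hullD … ν.M₁ 1 (Ω 1)`, rfl),
the separation of `s`, the box-form meet `∃ x ∈ box …, ∃ y, π y ∈ Ω_j ∧ Within 3 x y`, and the floor side letter `F.L·(Mc + 44 + 4ρ + 2(F.L + (8F.L+2))) + 3 ≤ c ≤ ν.M₁`.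
[cite: Balaban1985Variational, (17) p.279, (144) p.300, (146) p.301; Balaban1985RegularSpaces, (1.3)–(1.7) p.77, p.98; Balaban1988Convergent, p.255, (2.13) p.256] -/
theorem plaqSmallOn_tildeTowerWide_at_token {Mc ρ c c₀ : ℕ} (hcE : F.L * (Mc + 11 * 4 + 4 * ρ + 2 * (F.L + ((4 + 4) * F.L + 2))) + 3 ≤ c)
    (ν : Stage7Numerics) {M : ℕ} (g : ℕ → ℝ) (K k : ℕ) (s : SeqOfRecord F ν M g K k) (hsep : Sect2.SeqSeparated ν.M₁ s)
    (hadm : c ≤ ν.M₁ ∧ k + c₀ ≤ F.m + K) (ε : ℕ → ℝ) (U : GaugeField (F.P K) 0 (SU N))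
    (h17 : ∀ m, m ≤ k → PlaqSmallOn (Sect2.omegaPlaqsTop s.Ω (suppDomOfRecord F ν K s.Ω) m) (ε m * (F.P K).eta m ^ 2) U)
    {j : ℕ} (hj1 : 1 ≤ j) (hjk : j ≤ k) (idx : Pt (F.P K).d)
    (hdat : ∃ x ∈ box (F.P K).L (cornerP (F.P K) Mc ρ idx) (sideP (F.P K) Mc ρ) j, ∃ y : Pt (F.P K).d, cover (F.P K) y ∈ s.Ω j ∧ Within ((3 : ℕ) : ℤ) x y) :
    PlaqSmallOn {q : Plaq (F.P K) 0 | ∃ x : Fin (F.P K).d → ℤ,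
        (∀ κ, tlo (F.P K).L (tLo (cornerP (F.P K) Mc ρ idx) ρ) j κ - ((((F.P K).L + (((F.P K).d + 4) * (F.P K).L + 2)) * gs (F.P K).L j : ℕ) : ℤ) ≤ x κ ∧
          x κ ≤ thi (F.P K).L (tHi (cornerP (F.P K) Mc ρ idx) (sideP (F.P K) Mc ρ) ρ) j κ + ((((F.P K).L + (((F.P K).d + 4) * (F.P K).L + 2)) * gs (F.P K).L j : ℕ) : ℤ)) ∧
          q.src = castSite x}
      ((((F.P K).L : ℝ) ^ 2 * ε (j - 1)) * (F.P K).eta j ^ 2) U := by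
  have hM₁ : 1 ≤ ν.M₁ := le_trans (by omega) (hcE.trans hadm.1)
  have hfloor : (F.P K).L * (Mc + 11 * (F.P K).d + 4 * ρ + 2 * ((F.P K).L + (((F.P K).d + 4) * (F.P K).L + 2))) + 3 ≤ ν.M₁ := by
    rw [T4Family.P_L, T4Family.P_d]; exact hcE.trans hadm.1
  obtain ⟨x, hx, y, hy, hxy⟩ := hdat
  intro q hq
  obtain ⟨z, hz, hsrc⟩ := hq
  rw [← mul_eta_pred_sq (F.P K) (ε (j - 1)) hj1]
  exact h17 (j - 1) (by omega) q (mem_omegaPlaqsTop_pred_of_mem_box_of_mem_tildeTowerWide_zero hM₁ s hsep hfloor hj1 hjk hx hy hxy hz hsrc)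

omit [NeZero N] in
/-- ★ **THE `α₀`-RANGES AT `α₀ := L²ε′` FROM `ε′ ≤ a₀`** and the two displayed smallness letters on `a₀` (the head's ∃-chosen range letter): `0 < L²ε′`, `143((d+4)²∕4)²·L²ε′ ≤ ⅓`,
`2L²ε′ ≤ 2δ_N∕((d+4)L)²` (`d = 4`: `(d+4)²∕4 = 16`). [cite: Balaban1985Averaging, Prop. 2 (52)–(53) p.26 (the threshold); Balaban1985RegularSpaces, Lemma 1 (1.25) p.79] -/
theorem alpha_ranges_of_le (K : ℕ) {ε' a₀ : ℝ} (hε : 0 < ε') (hεa : ε' ≤ a₀)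
    (ha3 : 143 * ((16 : ℝ) ^ 2) * ((F.L : ℝ) ^ 2 * a₀) ≤ 1 / 3) (ha2 : 2 * ((F.L : ℝ) ^ 2 * a₀) ≤ 2 * deltaSU (Fin N) / (((8 * F.L : ℕ) : ℝ)) ^ 2) :
    0 < ((F.P K).L : ℝ) ^ 2 * ε' ∧ (143 * (((((F.P K).d + 4 : ℕ) : ℝ)) ^ 2 / 4) ^ 2) * (((F.P K).L : ℝ) ^ 2 * ε') ≤ 1 / 3 ∧
      2 * (((F.P K).L : ℝ) ^ 2 * ε') ≤ 2 * deltaSU (Fin N) / ((((F.P K).d + 4) * (F.P K).L : ℕ) : ℝ) ^ 2 := by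
  have hL0 : 0 < F.L := by have := (F.P K).L_pos; rwa [T4Family.P_L] at this
  rw [T4Family.P_L, T4Family.P_d]
  have hL : (0 : ℝ) < (F.L : ℝ) ^ 2 := by positivity
  have hmono : (F.L : ℝ) ^ 2 * ε' ≤ (F.L : ℝ) ^ 2 * a₀ := mul_le_mul_of_nonneg_left hεa hL.le
  refine ⟨mul_pos hL hε, ?_, ?_⟩
  · have h16 : ((((4 + 4 : ℕ) : ℝ)) ^ 2 / 4) = 16 := by norm_num
    rw [h16]
    nlinarith
  · have h8 : (((4 + 4) * F.L : ℕ) : ℝ) = ((8 * F.L : ℕ) : ℝ) := by norm_num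
    rw [h8]
    linarith

/-- ★ **STRICT NON-WRAPPING OF `□̃` FROM THE LEVEL GUARD**: `sideP Mc ρ + 4ρ ≤ Mc + 44 + 6ρ < 2F.L^{c₀} ≤ sitesPerDir j` for `j ≤ k`, `k + c₀ ≤ F.m + K` (side letter `Mc + 44 + 6ρ + 1 ≤ 2F.L^{c₀}`
— one more than the head's `≤`, which is `=` in the corner case `ρ ∣ Mc + 44`; `c₀` is ∃-chosen by `exists_le_two_mul_pow`). [cite: Balaban1987RG1, (0.1) p.251; Balaban1985RegularSpaces, p.98] -/
theorem sideP_add_lt_sitesPerDir_of_levelGuard {Mc ρ c₀ K k j : ℕ} (hc₀ : Mc + 11 * 4 + 6 * ρ + 1 ≤ 2 * F.L ^ c₀) (hlev : k + c₀ ≤ F.m + K) (hjk : j ≤ k) :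
    sideP (F.P K) Mc ρ + 4 * ρ < (F.P K).sitesPerDir j := by
  have hlevP : k + c₀ ≤ (F.P K).m + (F.P K).K := by rw [T4Family.P_m, T4Family.P_K]; exact hlev
  have h2 := two_mul_pow_le_sitesPerDir_of_levelGuard (P := F.P K) hjk hlevP
  rw [T4Family.P_L] at h2
  have hS := sideP_le (P := F.P K) Mc ρ
  rw [T4Family.P_d] at hS
  omega

/-- ★★★ **THE RADIAL SHEAR GAUGE AND ITS ROWS AT A CLEAN ANCHORED DATUM OF THE TOKEN** — the data-lane half of the S6 head's `HCHART` (its `hv` rows, FILE 7 :147–:149, with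
`U₁ := U^{u}`) and dag-n07-w8's (r2)-door binders `hax`∕`htop`, at the token's binders VERBATIM (dag-n07-w3 g7 :120's shape) plus the datum `1 ≤ j ≤ k`, `idx`, the box-form meet and the
four canonical-box equations; side letters: the floor `F.L·(Mc + 44 + 4ρ + 2(F.L + (8F.L+2))) + 3 ≤ c`, the strict period letter `Mc + 44 + 6ρ + 1 ≤ 2F.L^{c₀}`, the two `a₀`-smallness
letters.  For ANY `u`: `∃ uL`, (i) radial tower of `(U^{u})^{uL}` below `j`, (ii) the □̃-tower rows, (iii) the canonical-box rows — bound = the explicit ladder at `α₀ := L²·ε(j−1)`.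
[cite: Balaban1985Variational, (17) p.279, (144)–(147) pp.300–301, (151) p.301; Balaban1985RegularSpaces, (1.3)–(1.7) p.77, (1.15) p.78, Lemma 1 (1.25) p.79, p.98; Balaban1985Averaging, Prop. 2 (52)–(53) p.26; Balaban1988Convergent, p.255, (2.13) p.256; Balaban1987RG1, (0.1) p.251] -/
theorem exists_shearGauge_radialRep_rows_at_token {Mc ρ c c₀ : ℕ} (hcE : F.L * (Mc + 11 * 4 + 4 * ρ + 2 * (F.L + ((4 + 4) * F.L + 2))) + 3 ≤ c)
    (hc₀ : Mc + 11 * 4 + 6 * ρ + 1 ≤ 2 * F.L ^ c₀) {a₀ : ℝ}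
    (ha3 : 143 * ((16 : ℝ) ^ 2) * ((F.L : ℝ) ^ 2 * a₀) ≤ 1 / 3) (ha2 : 2 * ((F.L : ℝ) ^ 2 * a₀) ≤ 2 * deltaSU (Fin N) / (((8 * F.L : ℕ) : ℝ)) ^ 2)
    (ν : Stage7Numerics) {M : ℕ} (g : ℕ → ℝ) (K k : ℕ) (hρ : (F.P K).L ≤ ρ) (s : SeqOfRecord F ν M g K k) (hsep : Sect2.SeqSeparated ν.M₁ s)
    (hadm : c ≤ ν.M₁ ∧ k + c₀ ≤ F.m + K) (ε : ℕ → ℝ) (hε : ∀ m, m ≤ k → 0 < ε m ∧ ε m ≤ a₀)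
    (U : GaugeField (F.P K) 0 (SU N))
    (h17 : ∀ m, m ≤ k → PlaqSmallOn (Sect2.omegaPlaqsTop s.Ω (suppDomOfRecord F ν K s.Ω) m) (ε m * (F.P K).eta m ^ 2) U)
    {j : ℕ} (hj1 : 1 ≤ j) (hjk : j ≤ k) (idx : Pt (F.P K).d)
    (hdat : ∃ x ∈ box (F.P K).L (cornerP (F.P K) Mc ρ idx) (sideP (F.P K) Mc ρ) j, ∃ y : Pt (F.P K).d, cover (F.P K) y ∈ s.Ω j ∧ Within ((3 : ℕ) : ℤ) x y)
    {lo hi : ℕ → Pt (F.P K).d}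
    (hlo0 : lo 0 = fun i => ((F.P K).L : ℤ) * (sqLo (F.P K).L (cornerP (F.P K) Mc ρ idx) ρ j 1 i - 1))
    (hhi0 : hi 0 = fun i => ((F.P K).L : ℤ) * (sqHi (F.P K).L (cornerP (F.P K) Mc ρ idx) (sideP (F.P K) Mc ρ) ρ j 1 i + 1) + (((F.P K).L : ℤ) - 1))
    (hloj : ∀ j', 1 ≤ j' → lo j' = sqLo (F.P K).L (cornerP (F.P K) Mc ρ idx) ρ j j' - 1)
    (hhij : ∀ j', 1 ≤ j' → hi j' = sqHi (F.P K).L (cornerP (F.P K) Mc ρ idx) (sideP (F.P K) Mc ρ) ρ j j' + 1)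
    (u : GaugeTransf (F.P K) 0 (SU N)) :
    ∃ uL : GaugeTransf (F.P K) 0 (SU N),
      (∀ i < j, AxialGauge (radialContourData (F.P K) i (SU N)) (Averaging.iter (avOfRecord F N K) i (gaugeAct uL (gaugeAct u U)))) ∧
      (∀ j' ≤ j, ∀ c : PBond (F.P K) j',
        c.src ∈ (castSite '' Set.Icc (tlo (F.P K).L (tLo (cornerP (F.P K) Mc ρ idx) ρ) (j - j')) (thi (F.P K).L (tHi (cornerP (F.P K) Mc ρ idx) (sideP (F.P K) Mc ρ) ρ) (j - j')) :
          Set (Site (F.P K) j')) →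
        c.tgt ∈ (castSite '' Set.Icc (tlo (F.P K).L (tLo (cornerP (F.P K) Mc ρ idx) ρ) (j - j')) (thi (F.P K).L (tHi (cornerP (F.P K) Mc ρ idx) (sideP (F.P K) Mc ρ) ρ) (j - j')) :
          Set (Site (F.P K) j')) →
        dist1 (Averaging.iter (avOfRecord F N K) j' (gaugeAct uL (gaugeAct u U)) c) ≤
          (((F.P K).d - 1 : ℕ) : ℝ) * ((sideP (F.P K) Mc ρ + 4 * ρ - 1 : ℕ) : ℝ) * (2 * (((F.P K).L : ℝ) ^ 2 * ε (j - 1))) +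
            (7 * ((((((F.P K).d + 2) * (F.P K).L : ℕ) : ℝ) ^ 2 / 4)) +
                ((((((F.P K).d + 1) * ((F.P K).L - 1) : ℕ) : ℝ)) + 1) *
                  (((((F.P K).d * ((F.P K).L - 1) + 1 : ℕ) : ℝ)) * (((((F.P K).d - 1 : ℕ) : ℝ) * (((F.P K).L - 1 : ℕ) : ℝ))))) *
              ∑ i ∈ Finset.Ico j' j, 2 * (((F.P K).L : ℝ) ^ 2 * ε (j - 1)) * ((((F.P K).L : ℝ) ^ i * (F.P K).eta j) ^ 2)) ∧
      (∀ j' ≤ j, ∀ c : PBond (F.P K) j', c.src ∈ (castSite '' Set.Icc (lo j') (hi j') : Set (Site (F.P K) j')) →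
        c.tgt ∈ (castSite '' Set.Icc (lo j') (hi j') : Set (Site (F.P K) j')) →
        dist1 (Averaging.iter (avOfRecord F N K) j' (gaugeAct uL (gaugeAct u U)) c) ≤
          (((F.P K).d - 1 : ℕ) : ℝ) * ((sideP (F.P K) Mc ρ + 4 * ρ - 1 : ℕ) : ℝ) * (2 * (((F.P K).L : ℝ) ^ 2 * ε (j - 1))) +
            (7 * ((((((F.P K).d + 2) * (F.P K).L : ℕ) : ℝ) ^ 2 / 4)) +
                ((((((F.P K).d + 1) * ((F.P K).L - 1) : ℕ) : ℝ)) + 1) *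
                  (((((F.P K).d * ((F.P K).L - 1) + 1 : ℕ) : ℝ)) * (((((F.P K).d - 1 : ℕ) : ℝ) * (((F.P K).L - 1 : ℕ) : ℝ))))) *
              ∑ i ∈ Finset.Ico j' j, 2 * (((F.P K).L : ℝ) ^ 2 * ε (j - 1)) * ((((F.P K).L : ℝ) ^ i * (F.P K).eta j) ^ 2)) := by
  have hρ0 : 0 < ρ := lt_of_lt_of_le (F.P K).L_pos hρ
  have hM : 1 ≤ sideP (F.P K) Mc ρ := by have := le_sideP (P := F.P K) Mc hρ0; omega
  have hjK : j ≤ (F.P K).m + (F.P K).K := by rw [T4Family.P_m, T4Family.P_K]; omega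
  have hwrap : sideP (F.P K) Mc ρ + 4 * ρ < (F.P K).sitesPerDir j := sideP_add_lt_sitesPerDir_of_levelGuard (F := F) hc₀ hadm.2 hjk
  obtain ⟨hα, hα3, hα2⟩ := alpha_ranges_of_le (F := F) (N := N) K (hε (j - 1) (by omega)).1 (hε (j - 1) (by omega)).2 ha3 ha2
  -- the (17) clause one level down, placed on the widened □̃ (box-form meet), read for `U^{u}` (gauge invariance)
  have h52 := plaqSmallOn_tildeTowerWide_at_token (F := F) (N := N) hcE ν g K k s hsep hadm ε U h17 hj1 hjk idx hdat
  have h52u := (plaqSmallOn_gaugeAct_iff _ _ u U).mpr h52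
  exact exists_shearGauge_radialRep_rows_of_fine hj1 hjK (gaugeAct u U) (cornerP (F.P K) Mc ρ idx) hM (by omega) hwrap hlo0 hhi0 hloj hhij hα hα3 hα2 h52u

/-- **THE EXPLICIT LADDER IS MONOTONE IN THE LETTER**: `T·2α + C′·Σ 2α·tᵢ ≤ T·2β + C′·Σ 2β·tᵢ` for `α ≤ β`, `T, C′, tᵢ ≥ 0` (real arithmetic). [cite: Balaban1985Variational, (151) p.301 (the bound is linear in the letter)] -/
theorem ladder_mono {T C : ℝ} (hT : 0 ≤ T) (hC : 0 ≤ C) (t : ℕ → ℝ) (ht : ∀ i, 0 ≤ t i) {α β : ℝ} (hαβ : α ≤ β) (j' j : ℕ) :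
    T * (2 * α) + C * ∑ i ∈ Finset.Ico j' j, 2 * α * t i ≤ T * (2 * β) + C * ∑ i ∈ Finset.Ico j' j, 2 * β * t i := by
  refine add_le_add (mul_le_mul_of_nonneg_left (by linarith) hT) (mul_le_mul_of_nonneg_left (Finset.sum_le_sum fun i _ => ?_) hC)
  exact mul_le_mul_of_nonneg_right (by linarith) (ht i)

/-- ★★ **THE SAME AT THE TOKEN, BOUND IN THE LEVEL-`j` LETTER `2ε_j`** (token comparability `ε(j−1) ≤ 2ε_j`): the letter function `v ε δ j j' := (d−1)(sideP+4ρ−1)·2(L²·2ε_j) +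
C′·Σ_{i∈[j',j)} 2(L²·2ε_j)(Lⁱη_j)²` that the head's ranged `HLETTERS` can sign from the level-`j` range facts alone.
[cite: Balaban1985Variational, (17) p.279, (144)–(147) pp.300–301, (151) p.301; Balaban1985RegularSpaces, (1.3)–(1.7) p.77, (1.15) p.78, Lemma 1 (1.25) p.79, p.98; Balaban1985Averaging, Prop. 2 (52)–(53) p.26; Balaban1988Convergent, p.255, (2.13) p.256; Balaban1987RG1, (0.1) p.251] -/
theorem exists_shearGauge_radialRep_rows_at_token_of_comp {Mc ρ c c₀ : ℕ} (hcE : F.L * (Mc + 11 * 4 + 4 * ρ + 2 * (F.L + ((4 + 4) * F.L + 2))) + 3 ≤ c)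
    (hc₀ : Mc + 11 * 4 + 6 * ρ + 1 ≤ 2 * F.L ^ c₀) {a₀ : ℝ}
    (ha3 : 143 * ((16 : ℝ) ^ 2) * ((F.L : ℝ) ^ 2 * a₀) ≤ 1 / 3) (ha2 : 2 * ((F.L : ℝ) ^ 2 * a₀) ≤ 2 * deltaSU (Fin N) / (((8 * F.L : ℕ) : ℝ)) ^ 2)
    (ν : Stage7Numerics) {M : ℕ} (g : ℕ → ℝ) (K k : ℕ) (hρ : (F.P K).L ≤ ρ) (s : SeqOfRecord F ν M g K k) (hsep : Sect2.SeqSeparated ν.M₁ s)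
    (hadm : c ≤ ν.M₁ ∧ k + c₀ ≤ F.m + K) (ε : ℕ → ℝ) (hε : ∀ m, m ≤ k → 0 < ε m ∧ ε m ≤ a₀) (hcomp : ∀ m, m < k → ε m ≤ 2 * ε (m + 1))
    (U : GaugeField (F.P K) 0 (SU N))
    (h17 : ∀ m, m ≤ k → PlaqSmallOn (Sect2.omegaPlaqsTop s.Ω (suppDomOfRecord F ν K s.Ω) m) (ε m * (F.P K).eta m ^ 2) U)
    {j : ℕ} (hj1 : 1 ≤ j) (hjk : j ≤ k) (idx : Pt (F.P K).d)
    (hdat : ∃ x ∈ box (F.P K).L (cornerP (F.P K) Mc ρ idx) (sideP (F.P K) Mc ρ) j, ∃ y : Pt (F.P K).d, cover (F.P K) y ∈ s.Ω j ∧ Within ((3 : ℕ) : ℤ) x y)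
    {lo hi : ℕ → Pt (F.P K).d}
    (hlo0 : lo 0 = fun i => ((F.P K).L : ℤ) * (sqLo (F.P K).L (cornerP (F.P K) Mc ρ idx) ρ j 1 i - 1))
    (hhi0 : hi 0 = fun i => ((F.P K).L : ℤ) * (sqHi (F.P K).L (cornerP (F.P K) Mc ρ idx) (sideP (F.P K) Mc ρ) ρ j 1 i + 1) + (((F.P K).L : ℤ) - 1))
    (hloj : ∀ j', 1 ≤ j' → lo j' = sqLo (F.P K).L (cornerP (F.P K) Mc ρ idx) ρ j j' - 1)
    (hhij : ∀ j', 1 ≤ j' → hi j' = sqHi (F.P K).L (cornerP (F.P K) Mc ρ idx) (sideP (F.P K) Mc ρ) ρ j j' + 1)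
    (u : GaugeTransf (F.P K) 0 (SU N)) :
    ∃ uL : GaugeTransf (F.P K) 0 (SU N),
      (∀ i < j, AxialGauge (radialContourData (F.P K) i (SU N)) (Averaging.iter (avOfRecord F N K) i (gaugeAct uL (gaugeAct u U)))) ∧
      (∀ j' ≤ j, ∀ c : PBond (F.P K) j',
        c.src ∈ (castSite '' Set.Icc (tlo (F.P K).L (tLo (cornerP (F.P K) Mc ρ idx) ρ) (j - j')) (thi (F.P K).L (tHi (cornerP (F.P K) Mc ρ idx) (sideP (F.P K) Mc ρ) ρ) (j - j')) :
          Set (Site (F.P K) j')) →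
        c.tgt ∈ (castSite '' Set.Icc (tlo (F.P K).L (tLo (cornerP (F.P K) Mc ρ idx) ρ) (j - j')) (thi (F.P K).L (tHi (cornerP (F.P K) Mc ρ idx) (sideP (F.P K) Mc ρ) ρ) (j - j')) :
          Set (Site (F.P K) j')) →
        dist1 (Averaging.iter (avOfRecord F N K) j' (gaugeAct uL (gaugeAct u U)) c) ≤
          (((F.P K).d - 1 : ℕ) : ℝ) * ((sideP (F.P K) Mc ρ + 4 * ρ - 1 : ℕ) : ℝ) * (2 * (((F.P K).L : ℝ) ^ 2 * (2 * ε j))) +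
            (7 * ((((((F.P K).d + 2) * (F.P K).L : ℕ) : ℝ) ^ 2 / 4)) +
                ((((((F.P K).d + 1) * ((F.P K).L - 1) : ℕ) : ℝ)) + 1) *
                  (((((F.P K).d * ((F.P K).L - 1) + 1 : ℕ) : ℝ)) * (((((F.P K).d - 1 : ℕ) : ℝ) * (((F.P K).L - 1 : ℕ) : ℝ))))) *
              ∑ i ∈ Finset.Ico j' j, 2 * (((F.P K).L : ℝ) ^ 2 * (2 * ε j)) * ((((F.P K).L : ℝ) ^ i * (F.P K).eta j) ^ 2)) ∧
      (∀ j' ≤ j, ∀ c : PBond (F.P K) j', c.src ∈ (castSite '' Set.Icc (lo j') (hi j') : Set (Site (F.P K) j')) →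
        c.tgt ∈ (castSite '' Set.Icc (lo j') (hi j') : Set (Site (F.P K) j')) →
        dist1 (Averaging.iter (avOfRecord F N K) j' (gaugeAct uL (gaugeAct u U)) c) ≤
          (((F.P K).d - 1 : ℕ) : ℝ) * ((sideP (F.P K) Mc ρ + 4 * ρ - 1 : ℕ) : ℝ) * (2 * (((F.P K).L : ℝ) ^ 2 * (2 * ε j))) +
            (7 * ((((((F.P K).d + 2) * (F.P K).L : ℕ) : ℝ) ^ 2 / 4)) +
                ((((((F.P K).d + 1) * ((F.P K).L - 1) : ℕ) : ℝ)) + 1) *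
                  (((((F.P K).d * ((F.P K).L - 1) + 1 : ℕ) : ℝ)) * (((((F.P K).d - 1 : ℕ) : ℝ) * (((F.P K).L - 1 : ℕ) : ℝ))))) *
              ∑ i ∈ Finset.Ico j' j, 2 * (((F.P K).L : ℝ) ^ 2 * (2 * ε j)) * ((((F.P K).L : ℝ) ^ i * (F.P K).eta j) ^ 2)) := by
  obtain ⟨uL, hax, htil, hcan⟩ := exists_shearGauge_radialRep_rows_at_token (F := F) (N := N) hcE hc₀ ha3 ha2 ν g K k hρ s hsep hadm ε hε U h17 hj1 hjk idx hdat
    hlo0 hhi0 hloj hhij u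
  have hαβ : ((F.P K).L : ℝ) ^ 2 * ε (j - 1) ≤ ((F.P K).L : ℝ) ^ 2 * (2 * ε j) := by
    refine mul_le_mul_of_nonneg_left ?_ (by positivity)
    have := hcomp (j - 1) (by omega)
    rwa [Nat.sub_add_cancel hj1] at this
  have hT : (0 : ℝ) ≤ (((F.P K).d - 1 : ℕ) : ℝ) * ((sideP (F.P K) Mc ρ + 4 * ρ - 1 : ℕ) : ℝ) := by positivity
  have hC : (0 : ℝ) ≤ 7 * ((((((F.P K).d + 2) * (F.P K).L : ℕ) : ℝ) ^ 2 / 4)) +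
      ((((((F.P K).d + 1) * ((F.P K).L - 1) : ℕ) : ℝ)) + 1) *
        (((((F.P K).d * ((F.P K).L - 1) + 1 : ℕ) : ℝ)) * (((((F.P K).d - 1 : ℕ) : ℝ) * (((F.P K).L - 1 : ℕ) : ℝ)))) := by positivity
  have hmono := fun j' => ladder_mono hT hC (fun i => ((((F.P K).L : ℝ) ^ i * (F.P K).eta j) ^ 2)) (fun i => by positivity) hαβ j' j
  exact ⟨uL, hax, fun j' hj' c hs ht => (htil j' hj' c hs ht).trans (hmono j'), fun j' hj' c hs ht => (hcan j' hj' c hs ht).trans (hmono j')⟩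

end Token

end Summit.QuantumFields.YangMills.BalabanUVNodes.N07TildeTowerLettersAtToken
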